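import Summits.RiemannHypothesis.RiemannHypothesis.Theorems.OddSectorOddOneSignedWindowsRobustImpliesRH
import Literature.NumberTheory.LFunctions.WeilGroundEnergyParitySplit
import HarnessLib

/-!
# The summit-equivalent core of route `OddSector`: the odd energy floor
# (helper for item stmt-RiemannHypothesis-17778, crux `OddSector.OddOneSignedWindows`; RH-free)

The route's deciding chain is `S ⟹ RH` with `S = OddOneSignedWindows` (one-signed real odd ground
state at unboundedly many windows), through the odd Barta floor (`OddBartaFloor_of`, stmt-17779)
and the odd negativity off the line (`oddNegativityOffLine_proof`, stmt-17780), both proved. This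
file isolates WHAT the chain consumes of `S`, as kernel-checked equivalences over the tree's
`weilOddGroundEnergy = ε_od`:

* `riemannHypothesis_iff_forall_weilOddGroundEnergy_nonneg` — **`RH ↔ ∀ a > 0, ε_od(a) ≥ 0`**,
  unconditionally (Yoshida's odd criterion in ground-energy form; its Literature version
  `yoshida_odd_criterion.riemannHypothesis_iff_weilOddGroundEnergy_nonneg` is conditional on the
  named fact `yoshida_odd_criterion`, whose hard half is supplied here Summit-side by
  `oddNegativityOffLine_proof`; the easy half is `weilOddGroundEnergy_nonneg_of_riemannHypothesis`,
  i.e. Weil positivity under RH via the discharged explicit formula).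
* `not_riemannHypothesis_iff_eventually_weilOddGroundEnergy_le_neg` — `¬RH ↔` beyond some height
  `ε_od(a) ≤ −η < 0`.
* `riemannHypothesis_iff_energyFloorWindows` — **`RH ↔ EFW`**, where
  `EFW := ∃ e → 0, ∀ A ∃ a ≥ A, ε_od(a) ≥ −e(a)` (an energy floor at unboundedly many windows).
* `energyFloorWindows_of_robustGoodWindows`, `energyFloorWindows_of_oddOneSignedWindows` — the
  Barta step, RH-free: the robust crux `S_rob` (hypothesis of
  `riemannHypothesis_of_robustGoodWindows`) and a fortiori the filed crux `S` give `EFW`, with floor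
  `e + e′` (`e` the supersolution defect of `stub_asmFloor`, `e′` the robustness budget).

So the chain factors as `S ⟹ S_rob ⟹ EFW ⟺ RH ⟺ (∀ a > 0, ε_od(a) ≥ 0)`: the SIGN content of the
crux (exact or robust one-signedness of the odd bottom state) is a sufficient condition for the
summit-equivalent core `EFW` and is not consumed otherwise; whether `RH ⟹ S` (or `⟹ S_rob`) holds
is a separate question about the fine structure of the odd minimiser, open, and not needed by the
route. Nothing here is new mathematics.
-/

noncomputable section

set_option linter.dupNamespace false

open MeasureTheory Set Filter Complex
open scoped Topology

namespace Summit.RiemannHypothesis.RiemannHypothesis.Theorems.OddSector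

open Literature.NumberTheory.LFunctions
open Summit.RiemannHypothesis.RiemannHypothesis.Theses.OddSector
open Summit.RiemannHypothesis.RiemannHypothesis.Theorems.OddBartaFloor

/-- **Yoshida's odd criterion in ground-energy form, unconditionally
(registered sub-goal `riemannHypothesis_iff_forall_weilOddGroundEnergy_nonneg` of item
stmt-RiemannHypothesis-17778):** `RH ↔ ε_od(a) ≥ 0` for every window `a > 0`. `→`: Weil
positivity under RH (`weilOddGroundEnergy_nonneg_of_riemannHypothesis`, discharged explicit
formula). `←`: if RH fails, `oddNegativityOffLine_proof` (stmt-17780) gives `η > 0` and, at every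
large window, a normalised odd window test of energy `≤ −η`, so `ε_od(a) ≤ −η < 0` there.
[cite: Yoshida1992HermitianForms, Prop. 1(1)] -/
theorem riemannHypothesis_iff_forall_weilOddGroundEnergy_nonneg :
    _root_.RiemannHypothesis ↔ ∀ a : ℝ, 0 < a → 0 ≤ weilOddGroundEnergy a := by
  refine ⟨fun hRH a _ => weilOddGroundEnergy_nonneg_of_riemannHypothesis hRH a, fun hpos => ?_⟩
  by_contra hRH
  obtain ⟨η, hη, A, hAneg⟩ := oddNegativityOffLine_proof hRH
  obtain ⟨h, hh, hsupp, hodd, hnorm, hneg⟩ := hAneg (max A 1) (le_max_left _ _)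
  have h1 : (0 : ℝ) < max A 1 := lt_of_lt_of_le one_pos (le_max_right _ _)
  have h2 : weilOddGroundEnergy (max A 1) ≤ -η :=
    (weilOddGroundEnergy_le hh hsupp hodd hnorm).trans hneg
  linarith [hpos _ h1]

/-- The same without the side condition `0 < a` (`ε_od(a) = 0` for `a ≤ 0` by convention).
[cite: Yoshida1992HermitianForms, Prop. 1(1)] -/
theorem riemannHypothesis_iff_forall_weilOddGroundEnergy_nonneg' :
    _root_.RiemannHypothesis ↔ ∀ a : ℝ, 0 ≤ weilOddGroundEnergy a :=
  ⟨fun hRH a => weilOddGroundEnergy_nonneg_of_riemannHypothesis hRH a,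
    fun h => riemannHypothesis_iff_forall_weilOddGroundEnergy_nonneg.2 fun a _ => h a⟩

/-- **Failure of RH is uniform odd negativity at every large window (registered sub-goal
`not_riemannHypothesis_iff_eventually_weilOddGroundEnergy_le_neg` of item
stmt-RiemannHypothesis-17778):** `¬RH ↔ ∃ η > 0, ∃ A, ∀ a ≥ A, ε_od(a) ≤ −η`. `→` is
`oddNegativityOffLine_proof` read through `weilOddGroundEnergy_le`; `←` because under RH
`ε_od ≥ 0` everywhere. [folklore] -/
theorem not_riemannHypothesis_iff_eventually_weilOddGroundEnergy_le_neg :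
    ¬ _root_.RiemannHypothesis ↔
      ∃ η : ℝ, 0 < η ∧ ∃ A : ℝ, ∀ a : ℝ, A ≤ a → weilOddGroundEnergy a ≤ -η := by
  constructor
  · intro hRH
    obtain ⟨η, hη, A, hAneg⟩ := oddNegativityOffLine_proof hRH
    refine ⟨η, hη, A, fun a ha => ?_⟩
    obtain ⟨h, hh, hsupp, hodd, hnorm, hneg⟩ := hAneg a ha
    exact (weilOddGroundEnergy_le hh hsupp hodd hnorm).trans hneg
  · rintro ⟨η, hη, A, hA⟩ hRH
    have h1 := hA A le_rfl
    have h2 := weilOddGroundEnergy_nonneg_of_riemannHypothesis hRH A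
    linarith

/-- **The summit-equivalent core of the route (registered sub-goal
`riemannHypothesis_iff_energyFloorWindows` of item stmt-RiemannHypothesis-17778):**
`RH ↔ EFW`, an energy floor `ε_od(a) ≥ −e(a)`, `e → 0`, at unboundedly many windows. `→` with
`e = 0` (Weil positivity under RH); `←` since an off-line zero forces `ε_od(a) ≤ −η` at every
large window, incompatible with `−e(a) ≤ ε_od(a)` once `e(a) < η`. [folklore] -/
theorem riemannHypothesis_iff_energyFloorWindows :
    _root_.RiemannHypothesis ↔ ∃ e : ℝ → ℝ, Tendsto e atTop (nhds 0) ∧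
      ∀ A : ℝ, ∃ a : ℝ, A ≤ a ∧ -e a ≤ weilOddGroundEnergy a := by
  constructor
  · intro hRH
    exact ⟨fun _ => 0, tendsto_const_nhds, fun A => ⟨A, le_rfl, by
      simpa using weilOddGroundEnergy_nonneg_of_riemannHypothesis hRH A⟩⟩
  · rintro ⟨e, he, hwin⟩
    by_contra hRH
    obtain ⟨η, hη, A, hA⟩ :=
      not_riemannHypothesis_iff_eventually_weilOddGroundEnergy_le_neg.1 hRH
    obtain ⟨A₁, hA₁⟩ := eventually_atTop.1 (he.eventually (Iio_mem_nhds hη))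
    obtain ⟨a, ha, hfloor⟩ := hwin (max A A₁)
    have h1 : weilOddGroundEnergy a ≤ -η := hA a (le_trans (le_max_left _ _) ha)
    have h2 : e a < η := hA₁ a (le_trans (le_max_right _ _) ha)
    linarith

/-- **The Barta step, RH-free (registered sub-goal `energyFloorWindows_of_robustGoodWindows` of
item stmt-RiemannHypothesis-17778):** robustly good windows (the hypothesis of
`riemannHypothesis_of_robustGoodWindows`: beyond every height a window with an odd ground state
`u`, `∫_{(0,a)} Re u·H_a > 0`, and weighted negative mass at most `e′(a)` times that pairing,
`e′ → 0`) give the energy floor `ε_od(a) ≥ −e(a) − e′(a)` at those windows, by the generalised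
Barta inequality (`weilOddGroundEnergy_add_mul_setIntegral_ge`) and the supersolution inequality
`T_a ≥ −e(a)H_a` (`stub_asmFloor`). No zeros of `ζ` enter. [folklore] -/
theorem energyFloorWindows_of_robustGoodWindows :
    (∃ e' : ℝ → ℝ, Tendsto e' atTop (nhds 0) ∧ ∀ A : ℝ, ∃ a : ℝ, A ≤ a ∧ ∃ u : ℝ → ℂ,
      IsWeilOddGroundState a u ∧
      0 < ∫ t in Ioo 0 a, (u t).re * weilOddThetaVector a t ∧
      ∫ t in Ioo 0 a, max (-(u t).re) 0 *
          (|Summit.RiemannHypothesis.RiemannHypothesis.Theorems.OddBartaFloor.oddThetaImage a t| +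
            weilOddThetaVector a t) ≤
        e' a * ∫ t in Ioo 0 a, (u t).re * weilOddThetaVector a t) →
      ∃ e : ℝ → ℝ, Tendsto e atTop (nhds 0) ∧
        ∀ A : ℝ, ∃ a : ℝ, A ≤ a ∧ -e a ≤ weilOddGroundEnergy a := by
  rintro ⟨e', he', hwin⟩
  obtain ⟨a₀, e, he, hfl⟩ := stub_asmFloor
  refine ⟨fun a => e a + e' a, by simpa using he.add he', fun A => ?_⟩
  -- eventually `|e a| ≤ 1`
  obtain ⟨A₁, hA₁⟩ := eventually_atTop.1
    ((show Tendsto (fun a => |e a|) atTop (nhds 0) by simpa using he.abs).eventually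
      (Iio_mem_nhds one_pos))
  obtain ⟨a, ha, u, hu, hI, hD⟩ := hwin (max (max (max A a₀) A₁) 1)
  have haA : A ≤ a := le_trans (le_trans (le_trans (le_max_left _ _) (le_max_left _ _))
    (le_max_left _ _)) ha
  have ha₀ : a₀ ≤ a := le_trans (le_trans (le_trans (le_max_right _ _) (le_max_left _ _))
    (le_max_left _ _)) ha
  have haA₁ : A₁ ≤ a := le_trans (le_trans (le_max_right _ _) (le_max_left _ _)) ha
  have ha1 : 0 < a := lt_of_lt_of_le one_pos (le_trans (le_max_right _ _) ha)
  have he1 : |e a| ≤ 1 := (hA₁ a haA₁).le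
  refine ⟨a, haA, ?_⟩
  -- the generalised Barta inequality at `a`
  have hB := weilOddGroundEnergy_add_mul_setIntegral_ge a (e a) ha1 he1 (hfl a ha₀) u hu
  set I := ∫ t in Ioo 0 a, (u t).re * weilOddThetaVector a t with hIdef
  have h3 : -(e' a * I) ≤ (weilOddGroundEnergy a + e a) * I := le_trans (by linarith) hB
  have h4 : 0 ≤ (weilOddGroundEnergy a + e a + e' a) * I := by nlinarith
  have h5 : 0 ≤ weilOddGroundEnergy a + e a + e' a := (mul_nonneg_iff_of_pos_right hI).1 h4
  linarith

/-- **The filed crux gives the energy floor (registered sub-goal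
`energyFloorWindows_of_oddOneSignedWindows` of item stmt-RiemannHypothesis-17778):**
`S ⟹ EFW` (through `S ⟹ S_rob`, `robustGoodWindows_of_oddOneSignedWindows`, and the Barta step).
With `riemannHypothesis_iff_energyFloorWindows` this re-derives `S ⟹ RH`
(`oddOneSignedWindows_imp_riemannHypothesis`) and exhibits `EFW` as the part of `S` the route's
deciding theorem uses. [folklore] -/
theorem energyFloorWindows_of_oddOneSignedWindows :
    Summit.RiemannHypothesis.RiemannHypothesis.Theses.OddSector.OddOneSignedWindows →
      ∃ e : ℝ → ℝ, Tendsto e atTop (nhds 0) ∧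
        ∀ A : ℝ, ∃ a : ℝ, A ≤ a ∧ -e a ≤ weilOddGroundEnergy a :=
  fun hS => energyFloorWindows_of_robustGoodWindows (robustGoodWindows_of_oddOneSignedWindows hS)

/-- **Corollary: the crux, the robust crux and RH.** `S → S_rob → RH` and `RH ↔ EFW`, assembled:
the filed crux is equivalent to "`S` and every window has `ε_od ≥ 0`". [folklore] -/
theorem oddOneSignedWindows_iff_and_forall_weilOddGroundEnergy_nonneg :
    Summit.RiemannHypothesis.RiemannHypothesis.Theses.OddSector.OddOneSignedWindows ↔
      Summit.RiemannHypothesis.RiemannHypothesis.Theses.OddSector.OddOneSignedWindows ∧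
        ∀ a : ℝ, 0 ≤ weilOddGroundEnergy a :=
  ⟨fun hS => ⟨hS, riemannHypothesis_iff_forall_weilOddGroundEnergy_nonneg'.1
    (riemannHypothesis_iff_energyFloorWindows.2 (energyFloorWindows_of_oddOneSignedWindows hS))⟩,
    fun h => h.1⟩

end Summit.RiemannHypothesis.RiemannHypothesis.Theorems.OddSector

end
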